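import Summits.QuantumAdvantage.QuantumAdvantage.Theorems.WbwObfuscatedGluedTreesKowPhPrograms
import Summits.QuantumAdvantage.QuantumAdvantage.Theorems.WbwObfuscatedGluedTreesKowRiCodeLink
import Literature.Computability.Complexity.OracleLazyTablesSupply

/-!
# `WbwObfuscatedGluedTrees` (stmt-QuantumAdvantage-2340) — line `knowledge-of-walk-split`, STAGE 7: the real PRF game
# of the reduction IS the real black-box walk game (stub `stub_gameReal`)

Helper file of the PRF hybrid (stage 7) of the line `knowledge-of-walk-split`.  The reduction `ℬ` of stage 7 is an
oracle machine which, against ANY oracle `O` and on coins `r`, outputs the bit "the walker `𝒜` on coins `r` wins the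
walk game against the ideal-II instance `(codeCycle T d, codeNaming T d)` of the table quadruple `T = tabOf μ O` read
off the oracle" (this behaviour is a HYPOTHESIS here; it is produced by `stub_reduction`).  In the REAL PRF game of
the scheduled product ensemble `schedEval Λ P` (key material `K` uniform on `4·keyPartLen n` bits, oracle
`z = i₀ i₁ x ↦ F_{kᵢ}(x)` on `(μ + 2)`-bit queries) the tables read off the oracle are the four tables
`v ↦ F_{kᵢ}(v)` of the keys cut off `K` (`tabOf_oracleOfFnAt_schedEval`), and the generator's naming / cycle datum
at key material `K` are ideal-II code at exactly those tables (`stub_codeLink`, stage 6).  Hence the acceptance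
probability of `ℬ` in the real PRF game is the real walk success probability `walkSuccessProb Λ P 𝒜 n` — both are
the same count over (key material, coins).

[cite: Goldreich2001, Def. 3.6.4] (the real PRF game); ChildsEtAl2003 §4 Game 1 (the walk game).
-/

set_option linter.dupNamespace false

noncomputable section

namespace Summit.QuantumAdvantage.QuantumAdvantage.Theorems.WbwObfuscatedGluedTrees.KnowledgeOfWalk.PrfHybrid

open Literature.Computability.Complexity Literature.Computability.QuantumComplexity
open Literature.Computability.QuantumComplexity.GluedTrees
open Literature.Computability.Cryptography Literature.Computability.Cryptography.ObfuscatedGluedTrees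
open Summit.QuantumAdvantage.QuantumAdvantage.Theorems.WbwObfuscatedGluedTrees.KnowledgeOfWalk.BlackBox
open Summit.QuantumAdvantage.QuantumAdvantage.Theorems.WbwObfuscatedGluedTrees.KnowledgeOfWalk.RealIdeal
open _root_.Computability

/-! ## The real PRF oracle read as tables -/

section Tables

/-- The table index of a query `tkey i ++ w` is `i` (the index reads only the first two bits). [folklore] -/
theorem keyIdx_tkey_append (i : Fin 4) (w : List Bool) : keyIdx (tkey i ++ w) = i := by
  have h : keyIdx (tkey i ++ w) = keyIdx (tkey i) := rfl
  rw [h, keyIdx_tkey]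

/-- Dropping the two key-index bits of `tkey i ++ w` leaves `w`. [folklore] -/
theorem drop_two_tkey_append (i : Fin 4) (w : List Bool) : (tkey i ++ w).drop 2 = w := rfl

/-- A table query `tkey i ++ v` (`v` of `μ` bits) has length `μ + 2`. [folklore] -/
theorem length_tkey_append_ofFn (i : Fin 4) {μ : ℕ} (v : Fin μ → Bool) :
    (tkey i ++ List.ofFn v).length = μ + 2 := by
  simp only [tkey, List.length_append, List.length_cons, List.length_nil, List.length_ofFn]
  omega

/-- **The real PRF oracle answers a table query by the PRF under the selected key**: the oracle of the scheduled
product ensemble at key material `K` answers `tkey i ++ v` by `F_{kᵢ}(v)`, `kᵢ = Λ.key n K i`. [cite: Goldreich2001, Def. 3.6.4] -/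
theorem oracleOfFnAt_schedEval_tkey (Λ : Params) (P : PuncturablePRFScheme) (n : ℕ) (K : List Bool) (i : Fin 4)
    (v : Fin (Λ.prfParam n) → Bool) :
    oracleOfFnAt (Λ.prfParam n + 2) (schedEval Λ P n K) (tkey i ++ List.ofFn v) =
      P.eval (Λ.prfParam n) (Λ.key n K i) (List.ofFn v) := by
  rw [oracleOfFnAt_apply_of_length_eq _ (length_tkey_append_ofFn i v)]
  simp only [schedEval, keyIdx_tkey_append, drop_two_tkey_append]

/-- **The tables read off the real PRF oracle are the tables of the four keys**:
`tabOf μ (F-oracle at key material K) = tablesOf P μ k₁ k₂ k₃ k₄`, `kᵢ₊₁ = Λ.key n K i`. [folklore] -/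
theorem tabOf_oracleOfFnAt_schedEval (Λ : Params) (P : PuncturablePRFScheme) (n : ℕ) (K : List Bool) :
    tabOf (Λ.prfParam n) (oracleOfFnAt (Λ.prfParam n + 2) (schedEval Λ P n K)) =
      tablesOf P (Λ.prfParam n) (Λ.key n K 0) (Λ.key n K 1) (Λ.key n K 2) (Λ.key n K 3) := by
  simp only [tabOf, tablesOf, oracleOfFnAt_schedEval_tkey]
  rfl

/-- **The real instance is ideal-II code at the tables read off the real PRF oracle** (no truncation:
`2d + 3 ≤ μ`, `d ≤ μ`): the code cycle / code naming of `tabOf μ (F-oracle at K)` are the generator's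
`Λ.cycleOfKey P n K` / `Λ.namingOf P n K`. [cite: ChildsEtAl2003, §2] -/
theorem code_tabOf_oracleOfFnAt_schedEval (Λ : Params) (P : PuncturablePRFScheme) (n : ℕ) (K : List Bool)
    (hℓ : labelLen (Λ.depth n) ≤ Λ.prfParam n) (hd : Λ.depth n ≤ Λ.prfParam n) :
    codeCycle (tabOf (Λ.prfParam n) (oracleOfFnAt (Λ.prfParam n + 2) (schedEval Λ P n K))) (Λ.depth n) =
        Λ.cycleOfKey P n K ∧
      codeNaming (tabOf (Λ.prfParam n) (oracleOfFnAt (Λ.prfParam n + 2) (schedEval Λ P n K))) (Λ.depth n) =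
        Λ.namingOf P n K := by
  obtain ⟨hN, hC⟩ :=
    stub_codeLink P (Λ.prfParam n) (Λ.depth n) (Λ.key n K 0) (Λ.key n K 1) (Λ.key n K 2) (Λ.key n K 3) hℓ hd
  rw [tabOf_oracleOfFnAt_schedEval]
  exact ⟨hC.symm, hN.symm⟩

end Tables

/-! ## The registered stub -/

/-- **Stub (the real game)**: for a reduction `ℬ` with the coins of `𝒜` which, against every oracle `O`, outputs the
bit "`𝒜` wins the walk game against the ideal-II instance of `tabOf μ O`", the real PRF game of the scheduled product
ensemble IS the real walk game of the landed generator (the real oracle reads as the tables of the four keys cut off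
the key material, and the generator's naming / cycle are ideal-II code at those tables, `stub_codeLink`).
[cite: Goldreich2001, Def. 3.6.4] -/
theorem stub_gameReal :
    ∀ (Λ : Params) (P : PuncturablePRFScheme) (𝒜 : OracleAdversary (List Bool)) (ℬ : OracleAdversary Bool) (n : ℕ),
      labelLen (Λ.depth n) ≤ Λ.prfParam n → Λ.depth n ≤ Λ.prfParam n → ℬ.coins = 𝒜.coins →
      (∀ (O : Oracle) (r : List Bool), r.length = 𝒜.coins.eval (gameInput n).length →
          ℬ.alg.run O (ℬ.fuel.eval (gameInput n).length) (boolPair (gameInput n) r) =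
            some (decide (WalkWin 𝒜.alg (𝒜.fuel.eval (gameInput n).length) (boolPair (gameInput n) r)
              (codeCycle (tabOf (Λ.prfParam n) O) (Λ.depth n)) (codeNaming (tabOf (Λ.prfParam n) O) (Λ.depth n))))) →
      prfRealProb (schedEval Λ P) (fun n => 4 * Λ.keyPartLen n) (fun n => Λ.prfParam n + 2) ℬ n =
        walkSuccessProb Λ P 𝒜 n := by
  intro Λ P 𝒜 ℬ n hℓ hd hcoins hrun
  obtain ⟨algB, coinsB, fuelB⟩ := ℬ
  dsimp only at hcoins hrun
  subst hcoins
  rw [prfRealProb, prfRealPMF, uniformBits, PMF.bind_map]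
  simp only [Function.comp_def, OracleAdversary.outputPMF_eq_map]
  rw [toReal_uniform_bind_uniform_map_apply, walkSuccessProb, Fintype.card_prod, Nat.cast_mul]
  congr 3
  refine Finset.filter_congr fun p _ => ?_
  rw [hrun _ _ (List.Vector.toList_length _), Option.some.injEq, decide_eq_true_iff]
  obtain ⟨hC, hN⟩ := code_tabOf_oracleOfFnAt_schedEval Λ P n p.1.toList hℓ hd
  rw [hC, hN]

end Summit.QuantumAdvantage.QuantumAdvantage.Theorems.WbwObfuscatedGluedTrees.KnowledgeOfWalk.PrfHybrid

end
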